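import Summits.MatrixMultiplication.MatrixMultiplication.Theorems.SoloInformedCwTwoShadow
import Summits.MatrixMultiplication.MatrixMultiplication.Theorems.SoloInformedCatalystDoor
import Literature.Computability.AlgebraicComplexity.DegenerationSpectralMonotone
import Literature.Computability.AlgebraicComplexity.KoszulYoungCertificate
import HarnessLib

/-!
# The self-direct-sum door for the shadow `T₂ = T(U₂)`: `m · R̃(t) ≤ R̲(t^{⊕m})`

Solo residency `solo-MatrixMultiplication-informed`, generation 29 (the SHADOW TEST of door D1 on
the algebra `U₂` of upper-triangular `2 × 2` matrices, `T₂ = tTwo`, `3 ≤ R̃(T₂) ≤ √14 < R̲(T₂) = 4`,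
`SoloInformedCwTwoShadow.lean`).

* `two_mul_asymptoticRank_le_algBorderRank_directSum_self`,
  `three_mul_asymptoticRank_le_algBorderRank_directSum_self`,
  `two_mul_asymptoticRank_pow_le_algBorderRank_directSum_kroneckerPow` — **the self-direct-sum
  door**, every field: a universal spectral point `F` attaining `R̃(t)` (Strassen duality, proved in
  the tree) is additive under `⊕` and lies below the border rank, so
  `m · R̃(t)^N ≤ R̲((t^{⊠N})^{⊕m})`.  Border rank is NOT additive in general (Schönhage), so the
  right-hand side can be `< m · R̲(t^{⊠N})`: a saving in a self-direct-sum is an asymptotic-rank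
  bound.  (The catalyst door D10 of `SoloInformedCatalystDoor.lean` is the case of a catalyst `s`
  with `Q̃(s)` subtracted; for `s = t` itself the better constant `R̃(t)` is subtracted.)
* `seven_le_algBorderRank_tTwo_directSum_self`, `algBorderRank_tTwo_directSum_self_le`,
  `eleven_le_algBorderRank_tTwo_directSum_three`, `algBorderRank_tTwo_directSum_three_le` —
  kernel certificates (`p = 1` Koszul–Young flattenings with unit pivots, `decide +kernel`):
  **`7 ≤ R̲(T₂ ⊕ T₂) ≤ 8`** and **`11 ≤ R̲(T₂ ⊕ T₂ ⊕ T₂) ≤ 12`** over every field.  The lower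
  bounds are all that Koszul flattenings give (`⌈3.5 m⌉` for `T₂^{⊕m}`; checked numerically for
  `m ≤ 4` and all `p`), and Strassen's commutator equations give the same numbers (`U₂ × U₂` has
  commutators of rank `≤ 2`); the additivity theorem of Buczyński–Postinghel–Rupniewski covers
  total formats `≤ 4` only (Thm. 1.3), so **`R̲(T₂ ⊕ T₂) ∈ {7, 8}` is open**.
* `asymptoticRank_tTwo_le_of_directSum_self`, `asymptoticRank_tTwo_le_seven_halves_of`,
  `asymptoticRank_tTwo_le_eleven_thirds_of` — **the door**: `R̲(T₂ ⊕ T₂) = 7` would give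
  `R̃(T₂) ≤ 7/2 < √14` (the tree record), and `R̲(T₂^{⊕3}) = 11` would give `R̃(T₂) ≤ 11/3 < √14`;
  by the certificates above these are the ONLY values of the lever at `m = 2, 3` with content, and
  the lever can never certify `R̃(T₂) < 7/2` (Koszul ceiling).

No sorry, no new axioms. Nothing here bounds `R̃(T₂)` below `√14` unconditionally; the open
numerical question `R̲(T₂ ⊕ T₂) = 7 ∨ 8` (a `6 × 6 × 6` tensor, the structure tensor of
`U₂ × U₂`) is the cheapest instance of border-rank (non-)additivity with an asymptotic consequence.
-/

noncomputable section

open scoped BigOperators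

universe u

namespace Summit.MatrixMultiplication.MatrixMultiplication.Theorems

open Literature.Computability.AlgebraicComplexity
open Literature.LinearAlgebra.Matrix

/-! ## The self-direct-sum door (every field) -/

/-- **`2 · R̃(t) ≤ R̲(t ⊕ t)`**: a universal spectral point attaining `R̃(t)` (Strassen duality) is
additive under `⊕` and bounded by the border rank. [cite: ChristandlVranaZuiddam2023, Prop. 1.6] -/
theorem two_mul_asymptoticRank_le_algBorderRank_directSum_self (K : Type) [Field K]
    {ι κ μ : Type} [Fintype ι] [Fintype κ] [Fintype μ] [DecidableEq ι] [DecidableEq κ]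
    [DecidableEq μ] (t : ι → κ → μ → K) :
    2 * asymptoticRank t ≤ (algBorderRank (directSumTensor t t) : ℝ) := by
  obtain ⟨F, hF, hFt⟩ := (strassen_duality_asymptoticRank_holds K t).2
  have hB : F (directSumTensor t t) ≤ (algBorderRank (directSumTensor t t) : ℝ) :=
    hF.le_of_algBorderRank_le _ le_rfl
  rw [hF.map_directSum, hFt] at hB
  linarith

/-- **`3 · R̃(t) ≤ R̲(t ⊕ t ⊕ t)`.** [cite: ChristandlVranaZuiddam2023, Prop. 1.6] -/
theorem three_mul_asymptoticRank_le_algBorderRank_directSum_self (K : Type) [Field K]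
    {ι κ μ : Type} [Fintype ι] [Fintype κ] [Fintype μ] [DecidableEq ι] [DecidableEq κ]
    [DecidableEq μ] (t : ι → κ → μ → K) :
    3 * asymptoticRank t ≤ (algBorderRank (directSumTensor t (directSumTensor t t)) : ℝ) := by
  obtain ⟨F, hF, hFt⟩ := (strassen_duality_asymptoticRank_holds K t).2
  have hB : F (directSumTensor t (directSumTensor t t)) ≤
      (algBorderRank (directSumTensor t (directSumTensor t t)) : ℝ) :=
    hF.le_of_algBorderRank_le _ le_rfl
  rw [hF.map_directSum, hF.map_directSum, hFt] at hB
  linarith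

/-- **`2 · R̃(t)^N ≤ R̲(t^{⊠N} ⊕ t^{⊠N})`** (the door at level `N`). [cite: ChristandlVranaZuiddam2023, Prop. 1.6] -/
theorem two_mul_asymptoticRank_pow_le_algBorderRank_directSum_kroneckerPow (K : Type) [Field K]
    {ι κ μ : Type} [Fintype ι] [Fintype κ] [Fintype μ] [DecidableEq ι] [DecidableEq κ]
    [DecidableEq μ] (t : ι → κ → μ → K) (N : ℕ) :
    2 * asymptoticRank t ^ N ≤
      (algBorderRank (directSumTensor (kroneckerPow t N) (kroneckerPow t N)) : ℝ) := by
  obtain ⟨F, hF, hFt⟩ := (strassen_duality_asymptoticRank_holds K t).2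
  have hB : F (directSumTensor (kroneckerPow t N) (kroneckerPow t N)) ≤
      (algBorderRank (directSumTensor (kroneckerPow t N) (kroneckerPow t N)) : ℝ) :=
    hF.le_of_algBorderRank_le _ le_rfl
  rw [hF.map_directSum, hF.map_kroneckerPow, hFt] at hB
  linarith

/-! ## Kernel certificates: `7 ≤ R̲(T₂ ⊕ T₂) ≤ 8`, `11 ≤ R̲(T₂ ⊕ T₂ ⊕ T₂) ≤ 12` -/

namespace SelfSumCert

open CatalystCert (frameSix intCast_directSumTensor)

/-- `T₂ ⊕ T₂` as an integer table in the frame `Fin 6` (blocks `{0,1,2}` and `{3,4,5}`).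
[cite: BurgisserClausenShokrollahi1997, Ex. 17.23(4)] -/
def tTwoTwice : Fin 6 → Fin 6 → Fin 6 → ℤ :=
  ApproxCert.ofEntries 6 6 6
    [((0, 0, 0), 1), ((0, 1, 1), 1), ((1, 2, 1), 1), ((2, 2, 2), 1), ((3, 3, 3), 1), ((3, 4, 4), 1),
      ((4, 5, 4), 1), ((5, 5, 5), 1)]

/-- `T₂ ⊕ T₂ ⊕ T₂` as an integer table in the frame `Fin 9` (blocks `{0,1,2}`, `{3,4,5}`, `{6,7,8}`).
[cite: BurgisserClausenShokrollahi1997, Ex. 17.23(4)] -/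
def tTwoThrice : Fin 9 → Fin 9 → Fin 9 → ℤ :=
  ApproxCert.ofEntries 9 9 9
    [((0, 0, 0), 1), ((0, 1, 1), 1), ((1, 2, 1), 1), ((2, 2, 2), 1), ((3, 3, 3), 1), ((3, 4, 4), 1),
      ((4, 5, 4), 1), ((5, 5, 5), 1), ((6, 6, 6), 1), ((6, 7, 7), 1), ((7, 8, 7), 1), ((8, 8, 8), 1)]

/-- The frame identification `Fin 3 ⊕ (Fin 3 ⊕ Fin 3) ≃ Fin 9`. [folklore] -/
def frameNine : Fin 3 ⊕ (Fin 3 ⊕ Fin 3) ≃ Fin 9 :=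
  (Equiv.sumCongr (Equiv.refl (Fin 3)) (finSumFinEquiv (m := 3) (n := 3))).trans finSumFinEquiv

/-- The table `tTwoTwice` IS `T₂ ⊕ T₂` (over `ℤ`) in the frame `frameSix`. [folklore] -/
theorem tTwoTwice_eq : ∀ x y z : Fin 3 ⊕ Fin 3,
    tTwoTwice (frameSix x) (frameSix y) (frameSix z) = directSumTensor tTwoInt tTwoInt x y z := by
  decide

/-- The table `tTwoThrice` IS `T₂ ⊕ (T₂ ⊕ T₂)` (over `ℤ`) in the frame `frameNine`. [folklore] -/
theorem tTwoThrice_eq : ∀ x y z : Fin 3 ⊕ (Fin 3 ⊕ Fin 3),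
    tTwoThrice (frameNine x) (frameNine y) (frameNine z) =
      directSumTensor tTwoInt (directSumTensor tTwoInt tTwoInt) x y z := by
  decide

/-- `p = 1` Koszul–Young certificate for `T₂ ⊕ T₂`: restricted along `M = (I₃ | I₃)`, the `18 × 18`
flattening has `14` certified independent rows with unit pivots (so `R̲ ≥ 7`).
[cite: LandsbergOttaviani2015, Thm. 2.1] -/
theorem tTwoTwice_kyCheck :
    intTriCheckUnit 14
      (KYCert.kyEntry 6 6 6 [[1, 0, 0, 1, 0, 0], [0, 1, 0, 0, 1, 0], [0, 0, 1, 0, 0, 1]] tTwoTwice)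
      [[(0, 1)], [(1, 1)], [(3, 1)], [(4, 1)], [(6, 1)], [(7, 1)], [(1, 1), (8, -1)], [(9, 1)],
        [(10, 1)], [(4, 1), (11, -1)], [(13, 1)], [(14, 1)], [(16, 1)], [(17, 1)]]
      [6, 2, 9, 5, 12, 13, 7, 15, 16, 10, 14, 8, 17, 11] = true := by
  decide +kernel

/-- `p = 1` Koszul–Young certificate for `T₂ ⊕ T₂ ⊕ T₂`: restricted along `M = (I₃ | I₃ | I₃)`, the
`27 × 27` flattening has `21` certified independent rows with unit pivots (so `R̲ ≥ ⌈21/2⌉ = 11`).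
[cite: LandsbergOttaviani2015, Thm. 2.1] -/
theorem tTwoThrice_kyCheck :
    intTriCheckUnit 21
      (KYCert.kyEntry 9 9 9
        [[1, 0, 0, 1, 0, 0, 1, 0, 0], [0, 1, 0, 0, 1, 0, 0, 1, 0], [0, 0, 1, 0, 0, 1, 0, 0, 1]] tTwoThrice)
      [[(0, 1)], [(1, 1)], [(3, 1)], [(4, 1)], [(6, 1)], [(7, 1)], [(9, 1)], [(10, 1)],
        [(1, 1), (11, -1)], [(12, 1)], [(13, 1)], [(4, 1), (14, -1)], [(15, 1)], [(16, 1)],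
        [(7, 1), (17, -1)], [(19, 1)], [(20, 1)], [(22, 1)], [(23, 1)], [(25, 1)], [(26, 1)]]
      [9, 2, 12, 5, 15, 8, 18, 19, 10, 21, 22, 13, 24, 25, 16, 20, 11, 23, 14, 26, 17] = true := by
  decide +kernel

/-- `7 ≤ R̲` for the table `tTwoTwice`, over every field. [cite: LandsbergOttaviani2015, Thm. 2.1] -/
theorem seven_le_algBorderRank_tTwoTwice (K : Type u) [Field K] :
    7 ≤ algBorderRank (fun i j l => (tTwoTwice i j l : K)) :=
  KYCert.le_algBorderRank_of_kyCheckUnit K _ _ tTwoTwice_kyCheck (by norm_num)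

/-- `11 ≤ R̲` for the table `tTwoThrice`, over every field. [cite: LandsbergOttaviani2015, Thm. 2.1] -/
theorem eleven_le_algBorderRank_tTwoThrice (K : Type u) [Field K] :
    11 ≤ algBorderRank (fun i j l => (tTwoThrice i j l : K)) :=
  KYCert.le_algBorderRank_of_kyCheckUnit K _ _ tTwoThrice_kyCheck (by norm_num)

end SelfSumCert

open SelfSumCert
open CatalystCert (frameSix intCast_directSumTensor)

/-- **`R̲(T₂ ⊕ T₂) ≥ 7` over every field** (Koszul–Young certificate, kernel-checked).
[cite: LandsbergOttaviani2015, Thm. 2.1] -/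
theorem seven_le_algBorderRank_tTwo_directSum_self (K : Type) [Field K] :
    7 ≤ algBorderRank (directSumTensor (tTwo K) (tTwo K)) := by
  have key := seven_le_algBorderRank_tTwoTwice K
  rw [← algBorderRank_reindex frameSix frameSix frameSix (fun i j l => (tTwoTwice i j l : K))] at key
  have e : directSumTensor (tTwo K) (tTwo K) =
      fun x y z => (tTwoTwice (frameSix x) (frameSix y) (frameSix z) : K) := by
    funext x y z
    rw [tTwoTwice_eq, intCast_directSumTensor]
    rfl
  rw [e]
  exact key

/-- **`R̲(T₂ ⊕ T₂ ⊕ T₂) ≥ 11` over every field** (Koszul–Young certificate, kernel-checked; note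
`11 > 10 = ⌈(3/2) · R̲-flattening⌉`: the odd case gains one by integrality).
[cite: LandsbergOttaviani2015, Thm. 2.1] -/
theorem eleven_le_algBorderRank_tTwo_directSum_three (K : Type) [Field K] :
    11 ≤ algBorderRank (directSumTensor (tTwo K) (directSumTensor (tTwo K) (tTwo K))) := by
  have key := eleven_le_algBorderRank_tTwoThrice K
  rw [← algBorderRank_reindex frameNine frameNine frameNine
    (fun i j l => (tTwoThrice i j l : K))] at key
  have inner : (fun a b c => ((directSumTensor tTwoInt tTwoInt a b c : ℤ) : K)) =
      directSumTensor (tTwo K) (tTwo K) := by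
    funext a b c
    rw [intCast_directSumTensor]
    rfl
  have e : directSumTensor (tTwo K) (directSumTensor (tTwo K) (tTwo K)) =
      fun x y z => (tTwoThrice (frameNine x) (frameNine y) (frameNine z) : K) := by
    funext x y z
    rw [tTwoThrice_eq, intCast_directSumTensor, inner]
    rfl
  rw [e]
  exact key

/-- `R̲(T₂ ⊕ T₂) ≤ 8` (subadditivity and `R̲(T₂) = 4`). [cite: BurgisserClausenShokrollahi1997, Ex. 17.23(4)] -/
theorem algBorderRank_tTwo_directSum_self_le (K : Type) [Field K] :
    algBorderRank (directSumTensor (tTwo K) (tTwo K)) ≤ 8 :=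
  calc algBorderRank (directSumTensor (tTwo K) (tTwo K))
      ≤ algBorderRank (tTwo K) + algBorderRank (tTwo K) := algBorderRank_directSumTensor_le_add _ _
    _ = 8 := by rw [algBorderRank_tTwo K]

/-- `R̲(T₂ ⊕ T₂ ⊕ T₂) ≤ 12`. [cite: BurgisserClausenShokrollahi1997, Ex. 17.23(4)] -/
theorem algBorderRank_tTwo_directSum_three_le (K : Type) [Field K] :
    algBorderRank (directSumTensor (tTwo K) (directSumTensor (tTwo K) (tTwo K))) ≤ 12 :=
  calc algBorderRank (directSumTensor (tTwo K) (directSumTensor (tTwo K) (tTwo K)))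
      ≤ algBorderRank (tTwo K) + algBorderRank (directSumTensor (tTwo K) (tTwo K)) :=
        algBorderRank_directSumTensor_le_add _ _
    _ ≤ 4 + 8 := Nat.add_le_add (algBorderRank_tTwo K).le (algBorderRank_tTwo_directSum_self_le K)

/-- **`R̲(T₂ ⊕ T₂) = 7 ∨ R̲(T₂ ⊕ T₂) = 8`** — and which one is OPEN (the smallest format,
`(3,3,3) + (3,3,3)`, not covered by the additivity theorem for total dimensions `≤ 4`).
[cite: BuczynskiPostinghelRupniewski2020, Thm. 1.3] [cite: LandsbergOttaviani2015, Thm. 2.1] -/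
theorem algBorderRank_tTwo_directSum_self_eq_seven_or_eight (K : Type) [Field K] :
    algBorderRank (directSumTensor (tTwo K) (tTwo K)) = 7 ∨
      algBorderRank (directSumTensor (tTwo K) (tTwo K)) = 8 := by
  have h7 := seven_le_algBorderRank_tTwo_directSum_self K
  have h8 := algBorderRank_tTwo_directSum_self_le K
  omega

/-! ## The door for `T₂` -/

/-- **`R̃(T₂) ≤ R̲(T₂ ⊕ T₂) / 2`.** [cite: ChristandlVranaZuiddam2023, Prop. 1.6] -/
theorem asymptoticRank_tTwo_le_of_directSum_self (K : Type) [Field K] {r : ℕ}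
    (h : algBorderRank (directSumTensor (tTwo K) (tTwo K)) ≤ r) :
    asymptoticRank (tTwo K) ≤ (r : ℝ) / 2 := by
  have key := two_mul_asymptoticRank_le_algBorderRank_directSum_self K (tTwo K)
  have hr : (algBorderRank (directSumTensor (tTwo K) (tTwo K)) : ℝ) ≤ r := by exact_mod_cast h
  linarith

/-- **The self-sum door, `m = 2`**: `R̲(T₂ ⊕ T₂) ≤ 7 ⇒ R̃(T₂) ≤ 7/2 < √14` (strictly below the
tree record `asymptoticRank_tTwo_le_sqrt_fourteen`). [cite: ChristandlVranaZuiddam2023, Prop. 1.6] -/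
theorem asymptoticRank_tTwo_le_seven_halves_of (K : Type) [Field K]
    (h : algBorderRank (directSumTensor (tTwo K) (tTwo K)) ≤ 7) :
    asymptoticRank (tTwo K) ≤ 7 / 2 ∧ (7 / 2 : ℝ) < Real.sqrt 14 := by
  refine ⟨by simpa using asymptoticRank_tTwo_le_of_directSum_self K h, ?_⟩
  rw [Real.lt_sqrt (by norm_num)]
  norm_num

/-- **The self-sum door, `m = 3`**: `R̲(T₂ ⊕ T₂ ⊕ T₂) ≤ 11 ⇒ R̃(T₂) ≤ 11/3 < √14`.
[cite: ChristandlVranaZuiddam2023, Prop. 1.6] -/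
theorem asymptoticRank_tTwo_le_eleven_thirds_of (K : Type) [Field K]
    (h : algBorderRank (directSumTensor (tTwo K) (directSumTensor (tTwo K) (tTwo K))) ≤ 11) :
    asymptoticRank (tTwo K) ≤ 11 / 3 ∧ (11 / 3 : ℝ) < Real.sqrt 14 := by
  have key := three_mul_asymptoticRank_le_algBorderRank_directSum_self K (tTwo K)
  have hr : (algBorderRank (directSumTensor (tTwo K) (directSumTensor (tTwo K) (tTwo K))) : ℝ) ≤ 11 := by
    exact_mod_cast h
  refine ⟨by linarith, ?_⟩
  rw [Real.lt_sqrt (by norm_num)]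
  norm_num

/-- **Koszul ceiling of the lever**: whatever `R̲(T₂ ⊕ T₂)` and `R̲(T₂^{⊕3})` turn out to be, the
bounds on `R̃(T₂)` obtainable from them through the door are `≥ 7/2` resp. `≥ 11/3` (the kernel
certificates `7 ≤ R̲(T₂ ⊕ T₂)`, `11 ≤ R̲(T₂^{⊕3})`); so the lever at `m ≤ 3` can at best move the
record `√14 ≈ 3.742` to `3.5`, never to `3 = R̃(T₂)` predicted by door D1.
[cite: LandsbergOttaviani2015, Thm. 2.1] [cite: ChristandlVranaZuiddam2023, Prop. 1.6] -/
theorem selfSum_lever_ceiling (K : Type) [Field K] :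
    (7 : ℝ) / 2 ≤ (algBorderRank (directSumTensor (tTwo K) (tTwo K)) : ℝ) / 2 ∧
      (11 : ℝ) / 3 ≤ (algBorderRank (directSumTensor (tTwo K) (directSumTensor (tTwo K) (tTwo K))) : ℝ) / 3 ∧
      3 * asymptoticRank (tTwo K) ≤
        (algBorderRank (directSumTensor (tTwo K) (directSumTensor (tTwo K) (tTwo K))) : ℝ) ∧
      2 * asymptoticRank (tTwo K) ≤ (algBorderRank (directSumTensor (tTwo K) (tTwo K)) : ℝ) := by
  refine ⟨?_, ?_, three_mul_asymptoticRank_le_algBorderRank_directSum_self K (tTwo K),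
    two_mul_asymptoticRank_le_algBorderRank_directSum_self K (tTwo K)⟩
  · have h7 : (7 : ℝ) ≤ algBorderRank (directSumTensor (tTwo K) (tTwo K)) := by
      exact_mod_cast seven_le_algBorderRank_tTwo_directSum_self K
    linarith
  · have h11 : (11 : ℝ) ≤ algBorderRank (directSumTensor (tTwo K) (directSumTensor (tTwo K) (tTwo K))) := by
      exact_mod_cast eleven_le_algBorderRank_tTwo_directSum_three K
    linarith

end Summit.MatrixMultiplication.MatrixMultiplication.Theorems

end
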